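import Summits.NavierStokesRegularity.NavierStokesRegularity.Theorems.RungBlowupCofinal.PrecessingLerayReduction
import Literature.Analysis.FluidPDE.TsaiSelfSimilarHolds
import Mathlib.Analysis.SpecialFunctions.JapaneseBracket
import HarnessLib

/-!
# On the precessing Leray line of K1, a profile with vanishing defect and no precession is trivial
# (route `AngularGalerkinLadder`, crux K1 `RungBlowupCofinal`; Negative lane)

Negative-lane bookkeeping for `stmt-NavierStokesRegularity-19959` (K1 of route №8), cell ns-blowup,
refuter5 (K5-71). Nothing here asserts a Theses declaration; no definition, no named fact.

The precessing-Leray reduction (`Theorems/RungBlowupCofinal/PrecessingLerayReduction.lean`,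
`isClassicalNSSolutionOn_pvAnsatz_forced`) turns a K1 instance at rung `L` into a PROFILE triple
`(V, Q, G)`: `V` smooth, divergence free, band-limited of degree `≤ L`, with Type-I decay
`‖V y‖ ≤ C/(‖y‖+1)` and `V ≢ 0`, `Q` smooth, and the rotating steady Leray system
`−νΔV + ½V + ½(y·∇)V + α·J₃V + (V·∇)V + ∇Q = G` whose DEFECT `G` must be co-band-limited. This file
records, in the kernel, the printed fact that pins the line OFF the Navier–Stokes manifold when there
is no precession: with `α = 0` and `G ≡ 0` the triple is an exact backward self-similar Leray profile
with rate `a = ½`, and Type-I decay of a continuous field puts it in `L⁴(ℝ³)`, so Tsai's Liouville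
theorem (tree theorem `tsai_selfsimilar_holds`, `3 < q < ∞`) forces `V ≡ 0`.

* `memLp_four_of_typeI_decay` — a continuous field with `‖V y‖ ≤ C/(‖y‖+1)` on `ℝ³` is in `L⁴`.
* `eq_zero_of_defect_eq_zero_of_alpha_eq_zero` — `α = 0`, `G ≡ 0`, decay ⇒ `V = 0` (any `ν > 0`).
* `defect_ne_zero_of_nontrivial_of_alpha_eq_zero` — contrapositive: every NONTRIVIAL decaying solution
  of the system with `α = 0` has `G z ≠ 0` somewhere; i.e. at `α = 0` every K1 candidate on this line,
  at every rung, carries a genuinely non-zero (co-band-limited) defect.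

What this is NOT: nothing is said for `α ≠ 0` (there `G ≡ 0` is an unforced precessing profile:
excluded by Pineau–Vicol only for `|α|` outside their middle band, open inside it), and nothing about
`¬RungBlowupCofinal`.
[cite: Tsai1998, Thm 1 (L^q profiles, 3 < q < ∞, are zero)]
-/

noncomputable section

namespace Summit.NavierStokesRegularity.AngularGalerkinLadderPrecessingAlphaZeroDefect

open MeasureTheory Set Function
open scoped Laplacian ContDiff ENNReal
open Literature.Analysis Literature.Analysis.FluidPDE
open Summit.NavierStokesRegularity.FluidComputer
open Summit.NavierStokesRegularity.FluidComputer.AngularLadder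

/-- **Type-I decay puts a continuous field in `L⁴(ℝ³)`**: `‖V y‖ ≤ C/(‖y‖+1)` for all `y` and `V`
continuous imply `MemLp V 4` (domination by `C⁴(1+‖y‖)⁻⁴`, integrable on `ℝ³` since `4 > 3`). [folklore] -/
theorem memLp_four_of_typeI_decay {V : EuclideanSpace ℝ (Fin 3) → EuclideanSpace ℝ (Fin 3)} {C : ℝ} (hVc : Continuous V)
    (hdec : ∀ y, ‖V y‖ ≤ C / (‖y‖ + 1)) : MemLp V 4 volume := by
  have hmeas : AEStronglyMeasurable V volume := hVc.aestronglyMeasurable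
  rw [← integrable_norm_rpow_iff hmeas (by norm_num) (by norm_num)]
  have h4 : (4 : ℝ≥0∞).toReal = ((4 : ℕ) : ℝ) := by norm_num
  rw [h4]
  simp_rw [Real.rpow_natCast]
  have hrank : (Module.finrank ℝ (EuclideanSpace ℝ (Fin 3)) : ℝ) < 4 := by
    rw [finrank_euclideanSpace, Fintype.card_fin]; norm_num
  have hint : Integrable (fun y : EuclideanSpace ℝ (Fin 3) => C ^ 4 * (1 + ‖y‖) ^ (-(4 : ℝ))) volume :=
    (integrable_one_add_norm hrank).const_mul _
  refine hint.mono' (hmeas.norm.pow 4) (Filter.Eventually.of_forall fun y => ?_)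
  rw [Real.norm_of_nonneg (pow_nonneg (norm_nonneg _) 4)]
  have hy : 0 < ‖y‖ + 1 := by positivity
  have h2 : ‖V y‖ ^ 4 ≤ (C / (‖y‖ + 1)) ^ 4 := pow_le_pow_left₀ (norm_nonneg _) (hdec y) 4
  have h3 : (1 + ‖y‖) ^ (-(4 : ℝ)) = ((‖y‖ + 1) ^ 4)⁻¹ := by
    rw [Real.rpow_neg (by positivity), show (4 : ℝ) = ((4 : ℕ) : ℝ) by norm_num,
      Real.rpow_natCast, add_comm]
  calc ‖V y‖ ^ 4 ≤ (C / (‖y‖ + 1)) ^ 4 := h2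
    _ = C ^ 4 * (1 + ‖y‖) ^ (-(4 : ℝ)) := by rw [h3, div_pow, div_eq_mul_inv]

/-- **No precession and no defect ⇒ no profile.** If `(V, Q)` are smooth, `V` is divergence free with
Type-I decay `‖V y‖ ≤ C/(‖y‖+1)`, and the rotating steady Leray system of the precessing line holds
with `α = 0` and defect `G ≡ 0` (any viscosity `ν > 0`, rate `½`), then `V = 0`: `(V, Q)` is an exact
Leray profile (`IsLerayProfile ν ½`) in `L⁴`, and Tsai's theorem applies. [cite: Tsai1998, Thm 1] -/
theorem eq_zero_of_defect_eq_zero_of_alpha_eq_zero {ν α C : ℝ} (hν : 0 < ν) (hα : α = 0)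
    {V G : EuclideanSpace ℝ (Fin 3) → EuclideanSpace ℝ (Fin 3)} {Q : EuclideanSpace ℝ (Fin 3) → ℝ} (hV : ContDiff ℝ ∞ V) (hQ : ContDiff ℝ ∞ Q)
    (heq : ∀ z, -(ν • (Δ V) z) + (1 / 2 : ℝ) • V z + (1 / 2 : ℝ) • fderiv ℝ V z z +
      α • angGen 2 V z + convect V V z + gradient Q z = G z)
    (hG : ∀ z, G z = 0) (hdiv : VectorCalculus.IsDivFree V)
    (hdec : ∀ y, ‖V y‖ ≤ C / (‖y‖ + 1)) : V = 0 := by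
  subst hα
  have hprof : IsLerayProfile ν (1 / 2) V Q :=
    { contDiff_velocity := hV.of_le (WithTop.coe_le_coe.mpr le_top)
      contDiff_pressure := hQ.of_le (WithTop.coe_le_coe.mpr le_top)
      profile_eq := fun y => by simpa [hG y] using heq y
      divFree := hdiv }
  exact tsai_selfsimilar_holds hν (by norm_num) hprof (q := 4) (by norm_num) (by norm_num)
    (memLp_four_of_typeI_decay hV.continuous hdec)

/-- **Contrapositive: at `α = 0` every nontrivial candidate carries a non-zero defect.** With the
hypotheses of the precessing-Leray reduction at `α = 0` and `V ≢ 0`, the defect `G` does not vanish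
identically — the line is strictly off the Navier–Stokes manifold at every rung. [cite: Tsai1998, Thm 1] -/
theorem defect_ne_zero_of_nontrivial_of_alpha_eq_zero {ν α C : ℝ} (hν : 0 < ν) (hα : α = 0)
    {V G : EuclideanSpace ℝ (Fin 3) → EuclideanSpace ℝ (Fin 3)} {Q : EuclideanSpace ℝ (Fin 3) → ℝ} (hV : ContDiff ℝ ∞ V) (hQ : ContDiff ℝ ∞ Q)
    (heq : ∀ z, -(ν • (Δ V) z) + (1 / 2 : ℝ) • V z + (1 / 2 : ℝ) • fderiv ℝ V z z +
      α • angGen 2 V z + convect V V z + gradient Q z = G z)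
    (hdiv : VectorCalculus.IsDivFree V) (hdec : ∀ y, ‖V y‖ ≤ C / (‖y‖ + 1))
    (hne : ∃ y, V y ≠ 0) : ∃ z, G z ≠ 0 := by
  by_contra hG
  push Not at hG
  obtain ⟨y, hy⟩ := hne
  exact hy (by rw [eq_zero_of_defect_eq_zero_of_alpha_eq_zero hν hα hV hQ heq hG hdiv hdec]; rfl)

end Summit.NavierStokesRegularity.AngularGalerkinLadderPrecessingAlphaZeroDefect

end
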